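import Mathlib.GroupTheory.GroupAction.Defs
import Mathlib.Data.Fintype.Card
import Mathlib.Algebra.MvPolynomial.Rename
import HarnessLib

/-!
# The trivial-action type synonym `TrivAct α`

Topic `Computability/AlgebraicComplexity`, namespace `Literature.Computability.AlgebraicComplexity`.

Infrastructure for Dawar–Wilsenach symmetric arithmetic circuits (`SymmetricArithCircuit.lean`,
A. Dawar, G. Wilsenach, *Symmetric Arithmetic Circuits*, Theory of Computing 21 (2025),
Defs. 2.2, 3.6, 3.7): the statements "a circuit over INVARIANT inputs is symmetric for free" and
"an ordinary straight-line program on top of symmetrically computed invariant generators is a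
symmetric circuit" need an index type on which a given group acts TRIVIALLY, as a typeclass
instance (the circuits' symmetry is phrased through `MulAction` instances on the variable and
output index types). Mathlib offers no such synonym (`OrderDual`, `Lex`, `ULift`, … transport an
existing action), and on `Fin n` the permutation action `Equiv.Perm.applyMulAction` is registered,
so a bare index type cannot be used. `TrivAct α` is `α` with EVERY monoid acting trivially.

* `TrivAct α` (a `def`, so instance search does not see through it), `TrivAct.wrap`/`TrivAct.unwrap`
  (the identity bijections, `TrivAct.equiv`), the `Fintype`/`DecidableEq`/`Inhabited` transports;
* `TrivAct.instMulAction : MulAction M (TrivAct α)` with `m • a = a` (`TrivAct.smul_def`);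
* `TrivAct.rename_wrap_rename_unwrap`: renamings of polynomials along `wrap`/`unwrap` are inverse.

Everything is folklore and proved; nothing here is a named fact.
-/

namespace Literature.Computability.AlgebraicComplexity

universe u v

/-- `TrivAct α`: the type `α` on which every monoid acts TRIVIALLY (a type synonym; use
`TrivAct.wrap`/`TrivAct.unwrap` to move elements across). [folklore] -/
def TrivAct (α : Type u) : Type u := α

namespace TrivAct

variable {α : Type u}

/-- The identity map `α → TrivAct α`. [folklore] -/
def wrap (a : α) : TrivAct α := a

/-- The identity map `TrivAct α → α`. [folklore] -/
def unwrap (a : TrivAct α) : α := a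

/-- `unwrap (wrap a) = a`. [folklore] -/
@[simp] theorem unwrap_wrap (a : α) : unwrap (wrap a) = a := rfl

/-- `wrap (unwrap a) = a`. [folklore] -/
@[simp] theorem wrap_unwrap (a : TrivAct α) : wrap (unwrap a) = a := rfl

/-- The identity bijection `α ≃ TrivAct α`. [folklore] -/
def equiv (α : Type u) : α ≃ TrivAct α := ⟨wrap, unwrap, unwrap_wrap, wrap_unwrap⟩

/-- `wrap` is injective. [folklore] -/
theorem wrap_injective : Function.Injective (wrap : α → TrivAct α) := (equiv α).injective

/-- `unwrap` is injective. [folklore] -/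
theorem unwrap_injective : Function.Injective (unwrap : TrivAct α → α) := (equiv α).symm.injective

/-- `TrivAct α` is finite when `α` is. [folklore] -/
instance [Fintype α] : Fintype (TrivAct α) := Fintype.ofEquiv α (equiv α)

/-- `TrivAct α` has decidable equality when `α` has. [folklore] -/
instance [DecidableEq α] : DecidableEq (TrivAct α) := fun a b => decEq (unwrap a) (unwrap b)

/-- `TrivAct α` is inhabited when `α` is. [folklore] -/
instance [Inhabited α] : Inhabited (TrivAct α) := ⟨wrap default⟩

/-- `TrivAct α` has as many elements as `α`. [folklore] -/
@[simp] theorem card_eq [Fintype α] : Fintype.card (TrivAct α) = Fintype.card α :=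
  Fintype.card_congr (equiv α).symm

/-- **The trivial action**: every monoid `M` acts on `TrivAct α` by `m • a = a`. [folklore] -/
instance instMulAction (M : Type v) [Monoid M] : MulAction M (TrivAct α) where
  smul _ a := a
  one_smul _ := rfl
  mul_smul _ _ _ := rfl

/-- The action on `TrivAct α` is trivial. [folklore] -/
@[simp] theorem smul_def {M : Type v} [Monoid M] (m : M) (a : TrivAct α) : m • a = a := rfl

/-- Renaming a polynomial along `wrap` and back along `unwrap` is the identity. [folklore] -/
@[simp] theorem rename_unwrap_rename_wrap {R : Type v} [CommSemiring R] (p : MvPolynomial α R) :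
    MvPolynomial.rename unwrap (MvPolynomial.rename wrap p) = p := by
  rw [MvPolynomial.rename_rename]
  exact MvPolynomial.rename_id_apply p

/-- Renaming a polynomial along `unwrap` and back along `wrap` is the identity. [folklore] -/
@[simp] theorem rename_wrap_rename_unwrap {R : Type v} [CommSemiring R] (p : MvPolynomial (TrivAct α) R) :
    MvPolynomial.rename wrap (MvPolynomial.rename unwrap p) = p := by
  rw [MvPolynomial.rename_rename]
  exact MvPolynomial.rename_id_apply p

end TrivAct

end Literature.Computability.AlgebraicComplexity
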